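import Summits.ResolutionOfSingularities.ResolutionOfSingularities.Theorems.HilbertSamuelEliminationSigmaMaxModificationsCorridor3WLadderMovingRows
import Summits.ResolutionOfSingularities.ResolutionOfSingularities.Theorems.HilbertSamuelEliminationCampaignW42NearChainResolution
import HarnessLib

/-!
# [OURS · L1 W4.2] «LIVENESS IS FREE» for the O2-type items `CampaignW42NearChainTermination` (stmt-ResolutionOfSingularities-19964)
# and `CampaignW42TertiaryTermination` (stmt-ResolutionOfSingularities-19965): modulo the kernel-provable moving compactness L∞
# they ARE the MOVING rows; and the summit from L∞ + the moving rows at all levels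

Cell res-hironaka, slot W4.2 (★L-G4 termination), statement campaign s42, prover seat res-L1-s42-pv-2 (gen 3); host route
HilbertSamuelElimination (DRAFT); pure proofs over the tree (`--supports stmt-ResolutionOfSingularities-19964`). AI bookkeeping,
weaker than expert review. NOTHING here is a statement of H. Hironaka's manuscript [Hironaka2017]; the OURS items are
consumed only as HYPOTHESES; no new definition.

## What is proved (namespace `…Theorems.CampaignW42`)

The chain's RULING STARVATION (CHAIN w42 v3.7 §0f, after res-L1-w42-idea-2): the tree's canonical step admits WAITING steps, so a
`NoNearChainFrom`-typed row is hostage to every older lineage, while the MOVING rows (`NoMovingNearChainFrom`: the marked point is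
blown up infinitely often, …CampaignW42Tertiary l.331) are starvation-free and ONE lemma, L∞ `Moving.MovingCompactness` (an infinite
`S(X, ν)` from a good state carries a MOVING chain of closed near points from SOME closed point of `X(ν)`; helpers p496952 …), pays
for the difference on the calibration side. This file records what that buys for the two all-level items filed for this seat:

* §1 `noNearChainFrom_of_forall_noMovingNearChain` — POINTWISE: given L∞, if no closed point of `X(ν)` starts a MOVING chain then
  no point of `X` starts ANY infinite chain of canonical near steps (`X` reduced of finite type over a field, `dim X ≤ N`, `ν` maximal,
  `ν ≠ Φ^{(N)}`); `noNearChainFrom_of_maxOriginNoMoving` — the same from the row `Moving.MaxOriginNoMovingNearChainAt p N ⊤`.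
* §2 ITEM 19964: `nearChainTermination_offPhi_of_movingRows` — L∞ ∧ `(∀ N, MaxOriginNoMovingNearChainAt p N ⊤)` ⇒
  `NearChainTermination p` at every maximal origin with `ν ≠ Φ^{(N)}` (the only values any consumer meets: `ν = Φ^{(N)}` maximal means
  `X` regular); converse `movingRows_of_nearChainTermination` free. So, modulo L∞, the summit-reduction item IS the all-level moving WB.
* §3 ITEM 19965: `tertiaryTermination_offPhi_of_movingAt` — L∞ ∧ `GeomDirDimNonincrease p` ∧ `(∀ e, TertiaryTerminationMovingAt p e)` ⇒
  `TertiaryTermination p` off `Φ^{(N)}`; with p476789's `tertiaryInvariantLaxExists_iff` the graded hypothesis is `∀ e, TertiaryInvariantLaxExists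
  p e` (`tertiaryTermination_offPhi_of_laxSlots`): at an isolated origin the point L∞ produces is the origin itself, so `StratumLiveness`
  (p474474) drops out of the assembly `tertiaryTermination_of_moving_of_liveness` — the isolated O2 item is EXACTLY «a Cossart–Schober-shaped
  lax invariant exists at every grade», nothing about waiting.
* §4 DOORS at level 3: `wtop3PointedM_of_tertiaryTerminationMovingAt : TertiaryTerminationMovingAt p 3 → Moving.Wtop3PointedM p` (the
  registered stub `stub_Wtop3M_pointed` of skeleton `w_ladder` v5 from the MOVING isolated item — weaker antecedent than the landed
  `Moving.wtop3PointedM_of_tertiaryTerminationAt`), `tertiaryTerminationMovingAt_of_maxOrigin`, `maxOriginNoMoving_top_of_nearChainTermination`.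
* §5 THE SUMMIT FROM L∞ AND THE MOVING ROWS: p488719's induction on dimension re-threaded with the off-`Φ` pointwise hypothesis
  (`resolutions_of_offPhi`, `nuMod_all_of_offPhi`, `hsBody_of_offPhi`) and the headlines
  `sigmaMaxModifications_of_movingRows : MovingCompactness → (∀ p prime, ∀ N, MaxOriginNoMovingNearChainAt p N ⊤) → SigmaMaxModifications`,
  `resolutionOfSingularities_of_movingRows : … → ResolutionOfSingularities`. Conditional; credits nothing; both hypotheses are OURS
  nodes (L∞ provable and being landed by the chain; the moving rows OPEN from dimension three = obstruction O2 of CJS §1.3).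

References: V. Cossart, U. Jannsen, S. Saito, LNM 2270 (2020), §1.3, Rem. 6.29 (1), p. 107, Def. 6.14/6.15, Cor. 6.18, Thm. 6.17
[CossartJannsenSaito2020]; CHAIN w42 v3.7 §0f; tree files …CampaignW42Tertiary (p474474), …TertiaryGenuine (p476789), …NearChain
(p487178), …NearChainResolution (p488719), …Corridor3WLadderMoving{Defs,·,Rows} (p496426 …), …MovingCompactnessLeastLabel (p496952).
-/

noncomputable section

set_option linter.dupNamespace false -- mandated namespace of this single-conjunct summit

open CategoryTheory AlgebraicGeometry TopologicalSpace Topology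

namespace Summit.ResolutionOfSingularities.ResolutionOfSingularities.Theorems

namespace CampaignW42

open Literature.AlgebraicGeometry.Resolution Literature.RingTheory.HilbertSamuel
open Summit.ResolutionOfSingularities.ResolutionOfSingularities.Theses.HilbertSamuelElimination
open Summit.ResolutionOfSingularities.ResolutionOfSingularities.Theorems.SigmaMaxModificationsCorridor3
open Summit.ResolutionOfSingularities.ResolutionOfSingularities.Theorems.SigmaMaxModificationsCorridor3.Moving
open Summit.ResolutionOfSingularities.ResolutionOfSingularities.Theorems.SigmaMaxModificationsCorridor3.Helpers
  (ClosedOriginGeomDirDimNonincrease QPointed chain_geomDirDim_le)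

universe u v

variable {p : ℕ}

/-! ## §1. Pointwise: given L∞, no moving chain from the closed points of `X(ν)` ⇒ no infinite chain at all -/

/-- **POINTWISE «LIVENESS IS FREE».** Given L∞ (`Moving.MovingCompactness`): on a reduced `X` of finite type over a field with
`dim X ≤ N`, `ν` maximal and `ν ≠ Φ^{(N)}`, if NO closed point of `X(ν)` starts a MOVING chain of canonical near steps along `S(X, ν)`
(functional admissible oracle), then NO point of `X` starts an infinite chain of canonical near steps of any grade — an infinite chain
makes `S(X, ν)` infinite (p475287), and L∞ turns an infinite `S(X, ν)` from the good initial state (p486671) into a moving chain.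
[cite: CossartJannsenSaito2020, Rem. 6.29 (1), p. 107] -/
theorem noNearChainFrom_of_forall_noMovingNearChain (hL : MovingCompactness.{u}) {k : Type u} [Field k]
    {R : ∀ S : Scheme.{u}, CentreSeq S → Prop} {N : ℕ} {ν : ℕ → ℕ} (hRf : OracleFunctional R) (hRa : OracleAdmissible R)
    {X : Scheme.{u}} [IsLocallyNoetherian X] (f : X ⟶ Spec (.of k)) [LocallyOfFiniteType f] [QuasiCompact f] [IsReduced X]
    (hdim : topologicalKrullDim X ≤ (N : WithBot ℕ∞)) (hmax : Maximal (· ∈ Scheme.hsValues X N) ν) (hν : ν ≠ iterPSum N Phi)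
    (hno : ∀ x' ∈ Scheme.hsStratum X N ν, IsClosed ({x'} : Set X) →
      NoMovingNearChainFrom R N ν (MarkedStage.init X x') fun _ => True)
    (x : X) (G : MarkedStage.{u} → Prop) : NoNearChainFrom R N ν (MarkedStage.init X x) G := by
  rintro ⟨c, h0, hstep, -⟩
  obtain ⟨c', hc'0, hc'⟩ := exists_chain_eq_of_reaches h0 hstep
  exact not_canonicalSequenceInfinite_of_forall_noMovingNearChain hL hRf (stateGood_init_general (k := k) hRa f hdim hmax hν) hno
    (canonicalSequenceInfinite_of_chain hc'0 hc')

/-- **The same from a MAXIMAL ORIGIN and the level-`N` moving row** `Moving.MaxOriginNoMovingNearChainAt p N ⊤` (every closed point of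
`X(ν)` is itself a maximal origin). [cite: CossartJannsenSaito2020, Rem. 6.29 (1), p. 107] -/
theorem noNearChainFrom_of_maxOriginNoMoving (hL : MovingCompactness.{u}) {N : ℕ}
    (hM : MaxOriginNoMovingNearChainAt.{u} p N fun _ => True)
    {R : ∀ S : Scheme.{u}, CentreSeq S → Prop} {ν : ℕ → ℕ} (hRf : OracleFunctional R) (hRa : OracleAdmissible R)
    {X : Scheme.{u}} [IsLocallyNoetherian X] {x : X} (hX : IsMaximalOrigin p N ν X x) (hν : ν ≠ iterPSum N Phi)
    (G : MarkedStage.{u} → Prop) : NoNearChainFrom R N ν (MarkedStage.init X x) G := by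
  obtain ⟨k, _, _, f, _, hft, hqc⟩ := hX.exists_structure
  haveI := hft
  haveI := hqc
  haveI : IsReduced X := hX.isReduced
  exact noNearChainFrom_of_forall_noMovingNearChain hL hRf hRa f hX.dim_le hX.maximal hν
    (fun x' hx' hx'cl => hM R hRf hRa ν X x' ⟨hX.exists_structure, hX.isReduced, hX.dim_le, hX.maximal, hx'cl, hx'⟩) x G

/-! ## §2. Item 19964 (`NearChainTermination p`) ⟺ the all-level moving WB, modulo L∞ (off `Φ^{(N)}`) -/

/-- **ITEM 19964 FROM L∞ AND THE MOVING ROWS (off `Φ^{(N)}`).** `MovingCompactness` and `∀ N, MaxOriginNoMovingNearChainAt p N ⊤` give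
`NearChainTermination p` at every maximal origin whose value is not the regular value `Φ^{(N)}` — the hypothesis shape every consumer of
the item has (p487563, p488435, p488719 carry `ν ≠ Φ^{(N)}`; §5 re-threads the summit through it). [cite: CossartJannsenSaito2020, Rem. 6.29 (1), p. 107] -/
theorem nearChainTermination_offPhi_of_movingRows (hL : MovingCompactness.{u})
    (hM : ∀ N, MaxOriginNoMovingNearChainAt.{u} p N fun _ => True) :
    ∀ (R : ∀ S : Scheme.{u}, CentreSeq S → Prop), OracleFunctional R → OracleAdmissible R →
      ∀ (N : ℕ) (ν : ℕ → ℕ) (X : Scheme.{u}) [IsLocallyNoetherian X] (x : X), IsMaximalOrigin p N ν X x →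
        ν ≠ iterPSum N Phi → NoNearChainFrom R N ν (MarkedStage.init X x) fun _ => True :=
  fun _ hRf hRa N _ _ _ _ hX hν => noNearChainFrom_of_maxOriginNoMoving hL (hM N) hRf hRa hX hν _

/-- Converse (free): `NearChainTermination p` gives every moving row, every level, every grade. [folklore] -/
theorem movingRows_of_nearChainTermination (h : NearChainTermination.{u} p) (N : ℕ) (G : MarkedStage.{u} → Prop) :
    MaxOriginNoMovingNearChainAt.{u} p N G :=
  fun R hRf hRa ν X _ x hX => ((h R hRf hRa N ν X x hX).mono fun _ _ => trivial).noMoving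

/-- In particular the ungraded moving row at every level. [folklore] -/
theorem maxOriginNoMoving_top_of_nearChainTermination (h : NearChainTermination.{u} p) (N : ℕ) :
    MaxOriginNoMovingNearChainAt.{u} p N fun _ => True :=
  movingRows_of_nearChainTermination h N _

/-! ## §3. Item 19965 (`TertiaryTermination p`): at isolated origins the point L∞ produces is the origin — `StratumLiveness` drops out -/

/-- **POINTWISE AT AN ISOLATED ORIGIN.** Given L∞: if the isolated origin `x` (`X(ν) = {x}`, `ν ≠ Φ^{(N)}`) starts no MOVING chain then it
starts no infinite chain at all (the closed point of `X(ν)` that L∞ produces can only be `x`). [cite: CossartJannsenSaito2020, p. 107] -/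
theorem noNearChainFrom_isolated_of_noMoving (hL : MovingCompactness.{u}) {R : ∀ S : Scheme.{u}, CentreSeq S → Prop} {N : ℕ}
    {ν : ℕ → ℕ} (hRf : OracleFunctional R) (hRa : OracleAdmissible R) {X : Scheme.{u}} [IsLocallyNoetherian X] {x : X}
    (hX : IsIsolatedOrigin p N ν X x) (hν : ν ≠ iterPSum N Phi)
    (hno : NoMovingNearChainFrom R N ν (MarkedStage.init X x) fun _ => True) (G : MarkedStage.{u} → Prop) :
    NoNearChainFrom R N ν (MarkedStage.init X x) G := by
  obtain ⟨k, _, _, f, _, hft, hqc⟩ := hX.exists_structure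
  haveI := hft
  haveI := hqc
  haveI : IsReduced X := hX.isReduced
  refine noNearChainFrom_of_forall_noMovingNearChain hL hRf hRa f hX.dim_le hX.maximal hν (fun x' hx' _ => ?_) x G
  rw [hX.stratum_eq, Set.mem_singleton_iff] at hx'
  subst hx'
  exact hno

/-- **The graded moving statements and `ē`-monotonicity exclude every MOVING chain from an isolated origin** (the grade is eventually
constant along the chain; the tail is a moving chain of constant grade from the same origin). [cite: CossartJannsenSaito2020, Thm. 3.10, p. 107] -/
theorem noMovingNearChainFrom_isolated_of_movingAt (hmono : GeomDirDimNonincrease.{u} p) (hmov : ∀ e, TertiaryTerminationMovingAt.{u} p e)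
    {R : ∀ S : Scheme.{u}, CentreSeq S → Prop} {N : ℕ} {ν : ℕ → ℕ} (hRf : OracleFunctional R) (hRa : OracleAdmissible R)
    {X : Scheme.{u}} [IsLocallyNoetherian X] {x : X} (hX : IsIsolatedOrigin p N ν X x) :
    NoMovingNearChainFrom R N ν (MarkedStage.init X x) fun _ => True := by
  rintro ⟨c, h0, hstep, -, hmov'⟩
  have hsc : ∀ n, InScope p R N ν (c n) := fun n => ⟨X, inferInstance, x, hX, reaches_chain h0 hstep n⟩
  have hg : ∀ n, (c (n + 1)).geomDirDim ≤ (c n).geomDirDim := fun n =>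
    hmono R hRf hRa N ν (c n) (c (n + 1)) (hsc n) (hstep n)
  obtain ⟨n₀, hn₀⟩ := eventually_const_of_succ_le (g := fun n => (c n).geomDirDim) hg
  exact hmov (c n₀).geomDirDim R hRf hRa N ν X x hX ⟨fun n => c (n₀ + n), reaches_chain h0 hstep n₀,
    fun n => hstep (n₀ + n), fun n => hn₀ n, io_shift hmov' n₀⟩

/-- **ITEM 19965 FROM L∞, `ē`-MONOTONICITY AND THE GRADED MOVING STATEMENTS (off `Φ^{(N)}`)** — the assembly
`tertiaryTermination_of_moving_of_liveness` (p476789) with `StratumLiveness p` REPLACED by L∞: at every isolated origin of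
characteristic `p` with `ν ≠ Φ^{(N)}`, no infinite chain of closed near points along `S(X, ν)`. [cite: CossartJannsenSaito2020, Thm. 3.10, p. 107] -/
theorem tertiaryTermination_offPhi_of_movingAt (hL : MovingCompactness.{u}) (hmono : GeomDirDimNonincrease.{u} p)
    (hmov : ∀ e, TertiaryTerminationMovingAt.{u} p e) :
    ∀ (R : ∀ S : Scheme.{u}, CentreSeq S → Prop), OracleFunctional R → OracleAdmissible R →
      ∀ (N : ℕ) (ν : ℕ → ℕ) (X : Scheme.{u}) [IsLocallyNoetherian X] (x : X), IsIsolatedOrigin p N ν X x →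
        ν ≠ iterPSum N Phi → NoNearChainFrom R N ν (MarkedStage.init X x) fun _ => True :=
  fun _ hRf hRa _ _ _ _ _ hX hν => noNearChainFrom_isolated_of_noMoving hL hRf hRa hX hν
    (noMovingNearChainFrom_isolated_of_movingAt hmono hmov hRf hRa hX) _

/-- **ITEM 19965 FROM L∞, `ē`-MONOTONICITY AND THE LAX TERTIARY-INVARIANT SLOTS at all grades** (`TertiaryInvariantLaxExists p e`,
p474474; `tertiaryTerminationMovingAt_of_laxExists`, p476789): off `Φ^{(N)}` the isolated O2 item is exactly «a Cossart–Schober-shaped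
lax invariant (non-increasing, dropping when the marked point is blown up) exists at every grade». [cite: CossartJannsenSaito2020, §1.3, p. 107, App. Facts 18.28 (1)] -/
theorem tertiaryTermination_offPhi_of_laxSlots (hL : MovingCompactness.{u}) (hmono : GeomDirDimNonincrease.{u} p)
    (hlax : ∀ e, TertiaryInvariantLaxExists.{u, v} p e) :
    ∀ (R : ∀ S : Scheme.{u}, CentreSeq S → Prop), OracleFunctional R → OracleAdmissible R →
      ∀ (N : ℕ) (ν : ℕ → ℕ) (X : Scheme.{u}) [IsLocallyNoetherian X] (x : X), IsIsolatedOrigin p N ν X x →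
        ν ≠ iterPSum N Phi → NoNearChainFrom R N ν (MarkedStage.init X x) fun _ => True :=
  tertiaryTermination_offPhi_of_movingAt hL hmono fun e => tertiaryTerminationMovingAt_of_laxExists (hlax e)

/-- Converse (free): `TertiaryTermination p` gives the graded moving statements (through `TertiaryTerminationAt`, p476789). [folklore] -/
theorem movingAt_of_tertiaryTermination (h : TertiaryTermination.{u} p) (e : ℕ) : TertiaryTerminationMovingAt.{u} p e :=
  tertiaryTerminationMovingAt_of_terminationAt fun R hRf hRa N ν X _ x hX => (h R hRf hRa N ν X x hX).mono fun _ _ => trivial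

/-! ## §4. Doors at level 3 and between the scopes -/

/-- **DOOR (moving, level 3): the registered stub `stub_Wtop3M_pointed` of skeleton `w_ladder` v5 from the MOVING isolated item at
grade 3**, `TertiaryTerminationMovingAt p 3 → Moving.Wtop3PointedM p` — a pointed maximal origin is an isolated origin, and a chain of
grade `≥ 3` at level `3` has constant grade `3` (`ē ≤ dim ≤ 3`, `Helpers.chain_geomDirDim_le`). Weaker antecedent than the landed
`Moving.wtop3PointedM_of_tertiaryTerminationAt`. [cite: CossartJannsenSaito2020, p. 107, §1.3] -/
theorem wtop3PointedM_of_tertiaryTerminationMovingAt (h : TertiaryTerminationMovingAt.{u} p 3) : Wtop3PointedM.{u} p := by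
  intro R hRf hRa ν X _ x hX hq
  rintro ⟨c, h0, hstep, hge, hmov⟩
  exact h R hRf hRa 3 ν X x ⟨hX.exists_structure, hX.isReduced, hX.dim_le, hX.maximal, hX.isClosed, hq⟩
    ⟨c, h0, hstep, fun n => le_antisymm (chain_geomDirDim_le hX h0 hstep n) (hge n), hmov⟩

/-- **DOOR between the scopes: the all-level moving rows at grade `e` give the isolated moving item at grade `e`.** [folklore] -/
theorem tertiaryTerminationMovingAt_of_maxOrigin {e : ℕ} (h : ∀ N, MaxOriginNoMovingNearChainAt.{u} p N fun s => s.geomDirDim = e) :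
    TertiaryTerminationMovingAt.{u} p e :=
  fun R hRf hRa N ν X _ x hX => h N R hRf hRa ν X x hX.isMaximalOrigin

/-- **`ē`-monotonicity between the scopes**: the chain's maximal-origin row `Helpers.ClosedOriginGeomDirDimNonincrease p N` at all levels
gives the campaign's isolated-scope `GeomDirDimNonincrease p` (p474474). [folklore] -/
theorem geomDirDimNonincrease_of_closedOrigin (h : ∀ N, ClosedOriginGeomDirDimNonincrease.{u} p N) : GeomDirDimNonincrease.{u} p :=
  fun R hRf hRa N ν s s' ⟨X, hXln, x, hX, hr⟩ hst => h N R hRf hRa ν s s' ⟨X, hXln, x, hX.isMaximalOrigin, hr⟩ hst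

/-! ## §5. The summit from L∞ and the moving rows at all levels (p488719 re-threaded off `Φ^{(N)}`) -/

section Summit

variable {k : Type} [Field k] {R : ∀ S : Scheme.{0}, CentreSeq S → Prop}

/-- **RESOLUTION SEQUENCES IN EVERY DIMENSION from the off-`Φ` pointwise statement** (p488719's `resolutions_of_nearChainTermination` with
its hypothesis weakened to the maximal origins with `ν ≠ Φ^{(N)}` — all it ever uses): for a field `k` of characteristic `p` and a
functional admissible oracle answering on resolvable schemes, every separated reduced `T` of finite type over `k` with `dim T ≤ d` carries
a blow-up sequence with permissible centres over `T ∖ Reg T` and regular last stage. [cite: CossartJannsenSaito2020, Rem. 6.29 (1), Cor. 6.18, Thm. 6.17] -/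
theorem resolutions_of_offPhi
    (h : ∀ (R : ∀ S : Scheme.{0}, CentreSeq S → Prop), OracleFunctional R → OracleAdmissible R →
      ∀ (N : ℕ) (ν : ℕ → ℕ) (X : Scheme.{0}) [IsLocallyNoetherian X] (x : X), IsMaximalOrigin p N ν X x →
        ν ≠ iterPSum N Phi → NoNearChainFrom R N ν (MarkedStage.init X x) fun _ => True)
    [CharP k p] (hRf : OracleFunctional R) (hRa : OracleAdmissible R)
    (hRtot : ∀ S : Scheme.{0}, (∃ t : CentreSeq S, t.AllPermissible ∧ t.CentresOver (Scheme.regularLocus S)ᶜ ∧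
      Literature.AlgebraicGeometry.Resolution.Scheme.IsRegular t.top) → ∃ t, R S t) (d : ℕ) :
    ∀ (T : Scheme.{0}) (g : T ⟶ Spec (.of k)) [IsSeparated g] [LocallyOfFiniteType g] [QuasiCompact g]
      [IsReduced T], topologicalKrullDim T ≤ (d : WithBot ℕ∞) →
      ∃ t : CentreSeq T, t.AllPermissible ∧ t.CentresOver (Scheme.regularLocus T)ᶜ ∧
        Literature.AlgebraicGeometry.Resolution.Scheme.IsRegular t.top := by
  induction d with
  | zero =>
    intro T g _ _ _ _ hdim
    refine exists_resolutionSeq_overField (k := k) (d := 0) (fun Y g' _ _ _ _ hdimY ν hmax hν => ?_) T g hdim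
    haveI : IsLocallyNoetherian Y := LocallyOfFiniteType.isLocallyNoetherian g'
    obtain ⟨s, -, hs⟩ := exists_isNuElimination_of_forall_noNearChain hRf hRa g' hdimY hmax hν
      (fun s _ Z hZ hZν hne => answers_of_dim_le_zero g' hdimY hν hdimY s Z hZ hZν hne)
      (fun y hy hycl => h R hRf hRa 0 ν Y y ⟨⟨k, ‹_›, ‹_›, g', ‹_›, ‹_›, ‹_›⟩, ‹_›, hdimY, hmax, hycl, hy⟩ hν)
    exact ⟨s, hs.1, SigmaMaxModifications.Sketch.nuEliminationData_of_isNuElimination CossartJannsenSaito2020_thm_3_10_1_holds g'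
      hdimY hmax s hs⟩
  | succ e ih =>
    intro T g _ _ _ _ hdim
    refine exists_resolutionSeq_overField (k := k) (d := e + 1) (fun Y g' _ _ _ _ hdimY ν hmax hν => ?_) T g hdim
    haveI : IsLocallyNoetherian Y := LocallyOfFiniteType.isLocallyNoetherian g'
    obtain ⟨s, -, hs⟩ := exists_isNuElimination_of_forall_noNearChain hRf hRa g' hdimY hmax hν
      (fun s _ Z hZ hZν hne => answers_of_resolutions hRtot ih g' hdimY hν hdimY s Z hZ hZν hne)
      (fun y hy hycl => h R hRf hRa (e + 1) ν Y y ⟨⟨k, ‹_›, ‹_›, g', ‹_›, ‹_›, ‹_›⟩, ‹_›, hdimY, hmax, hycl, hy⟩ hν)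
    exact ⟨s, hs.1, SigmaMaxModifications.Sketch.nuEliminationData_of_isNuElimination CossartJannsenSaito2020_thm_3_10_1_holds g'
      hdimY hmax s hs⟩

/-- **`ν`-MODIFICATION OF EVERY MAXIMAL STRATUM, EVERY DIMENSION, from the off-`Φ` pointwise statement** (the choice oracle, its
answers from `resolutions_of_offPhi`). [cite: CossartJannsenSaito2020, Def. 6.14, Rem. 6.29 (1)] -/
theorem nuMod_all_of_offPhi
    (h : ∀ (R : ∀ S : Scheme.{0}, CentreSeq S → Prop), OracleFunctional R → OracleAdmissible R →
      ∀ (N : ℕ) (ν : ℕ → ℕ) (X : Scheme.{0}) [IsLocallyNoetherian X] (x : X), IsMaximalOrigin p N ν X x →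
        ν ≠ iterPSum N Phi → NoNearChainFrom R N ν (MarkedStage.init X x) fun _ => True)
    [CharP k p] {X : Scheme.{0}} [IsLocallyNoetherian X] (f : X ⟶ Spec (.of k)) [IsSeparated f] [LocallyOfFiniteType f]
    [QuasiCompact f] [IsReduced X] {N : ℕ} (hdimN : topologicalKrullDim X ≤ (N : WithBot ℕ∞)) {d : ℕ}
    (hdimd : topologicalKrullDim X ≤ (d : WithBot ℕ∞)) {ν : ℕ → ℕ} (hmax : Maximal (· ∈ Scheme.hsValues X N) ν)
    (hν : ν ≠ iterPSum N Phi) : TameWild.NuMod X N d ν := by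
  obtain ⟨R, hRf, hRa, hRtot⟩ := exists_choiceOracle.{0}
  have hdimN' : topologicalKrullDim X ≤ ((N + 1 : ℕ) : WithBot ℕ∞) :=
    hdimN.trans (by exact_mod_cast Nat.le_succ N)
  exact nuMod_of_forall_noNearChain hRf hRa f hdimN hdimd hmax hν
    (fun s _ Z hZ hZν hne => answers_of_resolutions hRtot (resolutions_of_offPhi h hRf hRa hRtot N) f hdimN hν hdimN' s Z hZ hZν hne)
    (fun x hx hxcl => h R hRf hRa N ν X x ⟨⟨k, ‹_›, ‹_›, f, ‹_›, ‹_›, ‹_›⟩, ‹_›, hdimN, hmax, hxcl, hx⟩ hν)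

/-- **THE CRUX BODY `B(X, N)` from the off-`Φ` pointwise statement** (CJS Def. 6.15; graded glue `TameWild.hsBody_of_nuMods'`).
[cite: CossartJannsenSaito2020, Def. 6.15, Rem. 6.24] -/
theorem hsBody_of_offPhi
    (h : ∀ (R : ∀ S : Scheme.{0}, CentreSeq S → Prop), OracleFunctional R → OracleAdmissible R →
      ∀ (N : ℕ) (ν : ℕ → ℕ) (X : Scheme.{0}) [IsLocallyNoetherian X] (x : X), IsMaximalOrigin p N ν X x →
        ν ≠ iterPSum N Phi → NoNearChainFrom R N ν (MarkedStage.init X x) fun _ => True)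
    (k : Type) [Field k] [CharP k p] (N : ℕ) (X : Scheme.{0}) (f : X ⟶ Spec (.of k)) (hsep : IsSeparated f)
    (hft : LocallyOfFiniteType f) (hqc : QuasiCompact f) (hred : IsReduced X) (hreg : ¬ Scheme.IsRegular X)
    (hdN : topologicalKrullDim X ≤ (N : WithBot ℕ∞)) : TameWild.HSBody X N := by
  refine TameWild.hsBody_of_nuMods' k N N (fun Y g hsep' hft' hqc' hred' hYN _ ν hν hνΦ => ?_) X f hsep hft hqc
    hred hreg hdN hdN
  haveI := hsep'
  haveI := hft'
  haveI := hqc'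
  haveI := hred'
  haveI : IsLocallyNoetherian Y := LocallyOfFiniteType.isLocallyNoetherian g
  exact nuMod_all_of_offPhi h g hYN hYN hν hνΦ

end Summit

/-- **`SigmaMaxModifications` (stmt-ResolutionOfSingularities-18506, by name) FROM L∞ AND THE MOVING ROWS AT ALL LEVELS AND PRIMES.**
Conditional; credits nothing: L∞ is an OURS node being landed by the chain (helpers p496952 …), the moving rows are OPEN from dimension
three (obstruction O2). [cite: CossartJannsenSaito2020, §1.3, Def. 6.15, Rem. 6.29 (1), p. 107] -/
theorem sigmaMaxModifications_of_movingRows (hL : MovingCompactness.{0})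
    (hM : ∀ p : ℕ, p.Prime → ∀ N, MaxOriginNoMovingNearChainAt.{0} p N fun _ => True) : SigmaMaxModifications := by
  intro p hp k _ _ X f hsep hft hqc hred hreg N hdim
  exact hsBody_of_offPhi (nearChainTermination_offPhi_of_movingRows hL (hM p hp)) k N X f hsep hft hqc hred hreg hdim

/-- **THE SUMMIT FROM L∞ AND THE MOVING ROWS: `MovingCompactness → (∀ p prime, ∀ N, MaxOriginNoMovingNearChainAt p N ⊤) →
ResolutionOfSingularities`** (through the route's proved bridge `ModificationsResolve_proof`). Conditional; credits nothing; the second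
hypothesis is the starvation-free form of the typed O2-type item (OPEN from dimension three). [cite: CossartJannsenSaito2020, §1.3, Cor. 6.18, Thm. 6.17, Rem. 6.29 (1)] -/
theorem resolutionOfSingularities_of_movingRows (hL : MovingCompactness.{0})
    (hM : ∀ p : ℕ, p.Prime → ∀ N, MaxOriginNoMovingNearChainAt.{0} p N fun _ => True) : _root_.ResolutionOfSingularities :=
  fun p hp => ModificationsResolve_proof (sigmaMaxModifications_of_movingRows hL hM) p hp

/-- **THE SUMMIT FROM `NearChainTermination` OFF `Φ^{(N)}`** (p488719's headline with the weaker hypothesis, for the record).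
[cite: CossartJannsenSaito2020, §1.3, Cor. 6.18, Thm. 6.17] -/
theorem resolutionOfSingularities_of_offPhi
    (h : ∀ p : ℕ, p.Prime → ∀ (R : ∀ S : Scheme.{0}, CentreSeq S → Prop), OracleFunctional R → OracleAdmissible R →
      ∀ (N : ℕ) (ν : ℕ → ℕ) (X : Scheme.{0}) [IsLocallyNoetherian X] (x : X), IsMaximalOrigin p N ν X x →
        ν ≠ iterPSum N Phi → NoNearChainFrom R N ν (MarkedStage.init X x) fun _ => True) :
    _root_.ResolutionOfSingularities :=
  fun p hp => ModificationsResolve_proof (fun q hq k _ _ X f hsep hft hqc hred hreg N hdim =>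
    hsBody_of_offPhi (h q hq) k N X f hsep hft hqc hred hreg hdim) p hp

end CampaignW42

end Summit.ResolutionOfSingularities.ResolutionOfSingularities.Theorems

end
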